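import Summits.QuantumFields.BalabanUV.Beta.GAN24.CombContactGaugeStaircaseCauchy

/-!
# `BalabanUV.Beta.GAN24.CombContactGaugeStaircaseCauchyPack` — binder row G-an2-4 ∕ (CONV-C), TRANSFER-III, the (III′) S-slot (b) of the END R `CombChargeRowsClosed`, the (III′)
# WILSON CONTACT RATE END `hCTd′`, step CT-4b AT THE COMB CHART, part 2: **THE PER-SCALE LETTERS OF THE TOP-ALIGNED DIFFERENCE STAIRCASE AND OF THE TRANSPORTED STAIRCASE** —
# the (III′) twin of road-P2 g34's `ContactGaugeStaircaseCauchy` §2 ∕ `…Pack` for MY `(k+3)`-staircases of `CombContactGaugeStaircaseCauchy` (`ΔG′`, `Gup′`): the (E) letters BY NAME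
# (`abs_gaugePieceDiff_le ∕ _zero_le ∕ abs_gaugePieceUp_le`) ⊕ the face letters (the OWNER's `abs_facePotential_legChain_single_le` for the transported and the extra finest face piece,
# MY `CombFacePotentialCauchy.abs_facePotential_legChain_succ_sub_le` for the differenced ones — `θ^k` UNIFORMLY in the scale).

NOT IN PRINT; OUR BOOKKEEPING (G-an2-4 formalisation swarm, leaf prover `b2b-balaban-gan24-formalise-leaf-01`, gen 89; [folklore] bookkeeping BY NAME; 0 `def`, 0 cited facts,
0 `def … : Prop`, 0 sorry).  HONEST FRAMING (cell contract, verbatim): «discharging `BetaPertH` makes Bałaban's UV stability UNCONDITIONAL — a real constructive-QFT result; it is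
NOT the continuum limit and NOT the Clay problem.»  HONEST DEPENDENCY (verbatim): «continuum YM on T⁴ ⇐ BetaPertH ∧ nine spine estimates (0/9 proved); BetaPertH ⇐ (D1) ∧ (D4) ∧
CAP+tail; G-an2-4 gates asym, D1 and NE2/3/4.»

WHAT (`d = 3`, in-block roots `r, rr`; (N1) `C, κ₀`; CT-4a `c, θ, κ₁`; face letter `F ≥ faceWtSum r Lc`; `c₁(κ) = 1 + 8·Lc·(e^κ + 1)`; fine′ lattice `u′`, envelope block `Lc^{k+2}`):
* **`abs_combPieceUp_le`** (`s′ ≤ k+2`): `|Gup′ s′ (blk (Lc^{s′}) u′)| ≤ ((8LcC + F·c₁(κ₀)·C)·(Lc^{5(k+2)})⁻¹·Lc^{s′})·e^{−κ₀…}` — tower `k+1`'s own letters (MY `CombContactGaugeStaircase` at `k+1`);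
* **`abs_combPieceDiff_le`** (`2 ≤ s′ ≤ k+2`): `|ΔG′ s′ (blk (Lc^{s′}) u′)| ≤ ((8Lc + F·c₁(κ₁))·(c·θ^k)·(Lc^{5(k+2)})⁻¹·Lc^{s′})·e^{−κ₁…}` — `θ^k ×` the undifferenced letters;
* **`abs_combPieceDiff_one_le`** (`s′ = 1`): the differenced (E) piece (`θ^k`-small) PLUS the taller tower's EXTRA finest FACE piece `|box|⁻¹·ζ_S (legAct (legChain R 0 (k+1)) δ)` (NOT small by
  `θ^k`: `F·c₁(κ₀)·C·(Lc^{5(k+2)})⁻¹·e^{−κ₀…}`); **`abs_combPieceDiff_zero_le`** (`s′ = 0`): the (E) extra finest piece (`8LcC·(Lc^{5(k+2)})⁻¹·e^{−κ₀…}`, road-P2's (δ)).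
So the (III′) difference staircase has TWO non-small finest pieces (scales `0` and `1`) where (E) had one; their pairing rows against the partner staircase are the consumer's (the (III′) twin
of road-P2's `ContactGaugeRefine`).  NO new estimate; discharges NOTHING of (hS, hSall); NEVER «G-an2-4 closed» as (CONV-C); NOT D1, NOT BetaPertH, NOT continuum, NOT Clay.  2026-08-28.
-/

noncomputable section

open Finset
open scoped BigOperators
open Literature.MathematicalPhysics.QuantumFieldTheory
open Literature.MathematicalPhysics.QuantumFieldTheory.LatticeForm (quo)
open Literature.MathematicalPhysics.QuantumFieldTheory.Balaban1983to89
open Literature.MathematicalPhysics.QuantumFieldTheory.Balaban1983to89.Beta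
open B4ContourShift (supNorm supNorm_nonneg)
open AffineAveraging (Form0 Form1 Site box toSite)
open AveragingContours (blk)
open KKTFluctuationKernel (delta1)
open BalabanCompositeJets (respStep)
open Summit.QuantumFields.BalabanUV.Beta.AxialProjectorBlockMean (bmGaugeAt)
open Summit.QuantumFields.BalabanUV.Beta.SymCorrectorForms (zetaS)
open Summit.QuantumFields.BalabanUV.Beta.SymCorrectorFace (faceWtSum faceWtSum_nonneg)
open Summit.QuantumFields.BalabanUV.Beta.GAN24.Push4Iter (legChain)
open Summit.QuantumFields.BalabanUV.Beta.GAN24.RespStepBmDecompLegs (legAct)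
open Summit.QuantumFields.BalabanUV.Beta.GAN24.RespStepBmDecompExact (respStepBmSeq blk_blk_pow)
open Summit.QuantumFields.BalabanUV.Beta.GAN24.RespStepBmDecompPsi (Psi)
open Summit.QuantumFields.BalabanUV.Beta.GAN24.DressedLegEnvelope (blk_pow_blk_pow single_eq_delta1)
open Summit.QuantumFields.BalabanUV.Beta.GAN24.StaircaseFaces (blk_one)
open Summit.QuantumFields.BalabanUV.Beta.GAN24.ContactGaugeStaircaseCauchy (abs_gaugePieceDiff_le abs_gaugePieceDiff_zero_le abs_gaugePieceUp_le abs_gaugePieceZero_le)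
open Summit.QuantumFields.BalabanUV.Beta.GAN24.CombLegChainGauge (facePotential facePotential_apply)
open Summit.QuantumFields.BalabanUV.Beta.GAN24.CombLegFaceSawtoothBlockL1 (abs_facePotential_legChain_single_le)
open Summit.QuantumFields.BalabanUV.Beta.GAN24.CombFacePotentialCauchy (abs_facePotential_legChain_succ_sub_le)

namespace Summit.QuantumFields.BalabanUV.Beta.GAN24.CombContactGaugeStaircaseCauchyPack

variable {Lc : ℕ} [NeZero Lc] {κ₀ C c θ κ₁ F : ℝ} (hκ₀ : 0 ≤ κ₀) (hC : 0 ≤ C) (hκ₁ : 0 ≤ κ₁) (hc : 0 ≤ c) (hθ : 0 ≤ θ)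
  (hN1 : ∀ (m k : ℕ) (μ : Fin (3 + 1)) (z : Site (3 + 1)) (l'' : Fin (3 + 1)) (w' : Site (3 + 1)),
    |respStep (d := 3) (Lc ^ m) (Lc ^ (m + k + 1)) μ z l'' w'| ≤
      C * ((Lc : ℝ) ^ (5 * (k + 1)))⁻¹ * Real.exp (-(κ₀ * supNorm (quo (Lc ^ (k + 1)) w' - z))))
  (hCau : ∀ (s k : ℕ) (μ : Fin (3 + 1)) (z : Site (3 + 1)) (l : Fin (3 + 1)) (w : Site (3 + 1)),
    |respStep (d := 3) (Lc ^ (s + 1)) (Lc ^ (s + k + 2)) μ z l w - respStep (d := 3) (Lc ^ s) (Lc ^ (s + k + 1)) μ z l w|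
      ≤ c * θ ^ (s + k) * ((((Lc ^ (k + 1) : ℕ) : ℝ)) ^ (3 + 2))⁻¹ * Real.exp (-(κ₁ * supNorm (quo (Lc ^ (k + 1)) w - z))))
  {r : Fin (3 + 1) → ℕ} (hr : r ∈ box (3 + 1) Lc) {rr : Fin (3 + 1) → ℕ} (hrr : rr ∈ box (3 + 1) Lc) (hF : faceWtSum r Lc ≤ F)

/-! ## §1 The transported staircase carries tower `k+1`'s own letters -/

section Up
include hκ₀ hC hN1 hr hrr hF

/-- NOT IN PRINT; OUR BOOKKEEPING.  **THE TRANSPORTED CONJUGATED PIECES CARRY THE TALLER TOWER's GEOMETRIC LETTERS** (`d = 3`, in-block roots; PARAMETRIC in (N1) and `F`): for every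
`s′ ≤ k+2` and `u′`, `|Gup′ s′ (blk (Lc^{s′}) u′)| ≤ ((8·Lc·C + F·(1+8Lc(e^{κ₀}+1))·C)·(Lc^{5(k+2)})⁻¹·Lc^{s′})·e^{−κ₀‖quo (Lc^(k+2)) u′ − z‖∞}` (`Gup′` of
`combGauge_coarse_eq_staircase_fine`) — road-P2's `abs_gaugePieceUp_le` ⊕ the OWNER's face envelope read one scale up (`(Lc^{4(i+1)})⁻¹·(Lc^{5(k−i+1)})⁻¹ = Lc^{i+1}·(Lc^{5(k+2)})⁻¹`). -/
theorem abs_combPieceUp_le (k : ℕ) (μ : Fin (3 + 1)) (z : Site (3 + 1)) {s' : ℕ} (hs : s' ≤ k + 2) (u' : Site (3 + 1)) :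
    |(fun (s' : ℕ) (y : Site (3 + 1)) =>
        (if s' = 0 then (0 : ℝ)
         else if s' ≤ k + 1 then
           -(((Lc : ℝ) ^ ((3 + 1) * s'))⁻¹ *
             bmGaugeAt (toSite rr) (legAct (respStep (d := 3) (Lc ^ (s' - 1)) (Lc ^ (k + 1))) (delta1 μ z)) Lc y)
         else 0)
        + (if s' ≤ 1 then (0 : ℝ)
           else ((Lc : ℝ) ^ ((3 + 1) * (s' - 1)))⁻¹ * ((((box (3 + 1) Lc).card : ℝ))⁻¹ *
             zetaS (toSite r) Lc (legAct (legChain (respStepBmSeq (d := 3) (toSite rr) Lc) (s' - 2) (k + 2 - s')) (delta1 μ z)) y)))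
        s' (blk (Lc ^ s') u')|
      ≤ ((8 * (Lc : ℝ) * C + F * (1 + 8 * (Lc : ℝ) * (Real.exp κ₀ + 1)) * C) * ((Lc : ℝ) ^ (5 * (k + 2)))⁻¹ * (Lc : ℝ) ^ s') *
          Real.exp (-(κ₀ * supNorm (quo (Lc ^ (k + 2)) u' - z))) := by
  have hL0 : (0 : ℝ) < Lc := by exact_mod_cast Nat.pos_of_ne_zero (NeZero.ne Lc)
  have hL1 : (1 : ℝ) ≤ Lc := by exact_mod_cast Nat.one_le_iff_ne_zero.2 (NeZero.ne Lc)
  have hF0 : 0 ≤ F := (faceWtSum_nonneg r Lc).trans hF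
  set E : ℝ := Real.exp (-(κ₀ * supNorm (quo (Lc ^ (k + 2)) u' - z))) with hE
  have hE0 : 0 ≤ E := (Real.exp_pos _).le
  set N5 : ℝ := ((Lc : ℝ) ^ (5 * (k + 2)))⁻¹ with hN5
  have hN50 : 0 ≤ N5 := by positivity
  -- the (E) part
  have hA : |(if s' = 0 then (0 : ℝ)
         else if s' ≤ k + 1 then
           -(((Lc : ℝ) ^ ((3 + 1) * s'))⁻¹ *
             bmGaugeAt (toSite rr) (legAct (respStep (d := 3) (Lc ^ (s' - 1)) (Lc ^ (k + 1))) (delta1 μ z)) Lc (blk (Lc ^ s') u'))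
         else 0)| ≤ 8 * (Lc : ℝ) * C * N5 * (Lc : ℝ) ^ s' * E := by
    by_cases hsk : s' ≤ k + 1
    · rw [if_pos hsk]
      have h := abs_gaugePieceUp_le (Lc := Lc) hC hN1 hrr k μ z hsk u'
      rw [← hE, ← hN5] at h
      exact h
    · rw [if_neg hsk, if_neg (show s' ≠ 0 by omega), abs_zero]; positivity
  -- the face part
  have hB : |(if s' ≤ 1 then (0 : ℝ)
           else ((Lc : ℝ) ^ ((3 + 1) * (s' - 1)))⁻¹ * ((((box (3 + 1) Lc).card : ℝ))⁻¹ *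
             zetaS (toSite r) Lc (legAct (legChain (respStepBmSeq (d := 3) (toSite rr) Lc) (s' - 2) (k + 2 - s')) (delta1 μ z)) (blk (Lc ^ s') u')))|
        ≤ F * (1 + 8 * (Lc : ℝ) * (Real.exp κ₀ + 1)) * C * N5 * (Lc : ℝ) ^ s' * E := by
    by_cases h1 : s' ≤ 1
    · rw [if_pos h1, abs_zero]; positivity
    · obtain ⟨i, rfl⟩ : ∃ i, s' = i + 2 := ⟨s' - 2, by omega⟩
      have hik : i ≤ k := by omega
      rw [if_neg h1, show i + 2 - 1 = i + 1 by omega, show i + 2 - 2 = i by omega, show k + 2 - (i + 2) = k - i by omega,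
        show blk (Lc ^ (i + 2)) u' = blk Lc (blk (Lc ^ (i + 1)) u') by rw [blk_blk_pow], ← facePotential_apply, ← single_eq_delta1,
        abs_mul, abs_inv, abs_pow, abs_of_pos hL0]
      have h := abs_facePotential_legChain_single_le hκ₀ hC hN1 hr hrr i (k - i) μ z (blk (Lc ^ (i + 1)) u')
      have hlab : quo (Lc ^ (k - i + 1)) (blk (Lc ^ (i + 1)) u') = quo (Lc ^ (k + 2)) u' := by
        show blk (Lc ^ (k - i + 1)) (blk (Lc ^ (i + 1)) u') = blk (Lc ^ (k + 2)) u'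
        rw [blk_pow_blk_pow, show i + 1 + (k - i + 1) = k + 2 by omega]
      rw [hlab, ← hE] at h
      have hB0 : 0 ≤ (1 + 8 * (Lc : ℝ) * (Real.exp κ₀ + 1)) * C * ((Lc : ℝ) ^ (5 * (k - i + 1)))⁻¹ * E := by positivity
      have h' := h.trans (mul_le_mul_of_nonneg_right hF hB0)
      have e : ((Lc : ℝ) ^ ((3 + 1) * (i + 1)))⁻¹ * ((Lc : ℝ) ^ (5 * (k - i + 1)))⁻¹ = N5 * (Lc : ℝ) ^ (i + 1) := by
        have e' : (Lc : ℝ) ^ (5 * (k + 2)) = (Lc : ℝ) ^ ((3 + 1) * (i + 1)) * (Lc : ℝ) ^ (5 * (k - i + 1)) * (Lc : ℝ) ^ (i + 1) := by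
          rw [← pow_add, ← pow_add]; congr 1; omega
        rw [hN5, e']; field_simp
      have hpow : (Lc : ℝ) ^ (i + 1) ≤ (Lc : ℝ) ^ (i + 2) := pow_le_pow_right₀ hL1 (by omega)
      calc ((Lc : ℝ) ^ ((3 + 1) * (i + 1)))⁻¹ *
            |facePotential r Lc (legAct (legChain (respStepBmSeq (d := 3) (toSite rr) Lc) i (k - i))
              (fun μ' y => if μ' = μ then (if y = z then (1 : ℝ) else 0) else 0)) (blk (Lc ^ (i + 1)) u')|
          ≤ ((Lc : ℝ) ^ ((3 + 1) * (i + 1)))⁻¹ * (F * ((1 + 8 * (Lc : ℝ) * (Real.exp κ₀ + 1)) * C * ((Lc : ℝ) ^ (5 * (k - i + 1)))⁻¹ * E)) :=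
            mul_le_mul_of_nonneg_left h' (by positivity)
        _ = F * (1 + 8 * (Lc : ℝ) * (Real.exp κ₀ + 1)) * C * N5 * (Lc : ℝ) ^ (i + 1) * E := by
            calc ((Lc : ℝ) ^ ((3 + 1) * (i + 1)))⁻¹ * (F * ((1 + 8 * (Lc : ℝ) * (Real.exp κ₀ + 1)) * C * ((Lc : ℝ) ^ (5 * (k - i + 1)))⁻¹ * E))
                = F * (1 + 8 * (Lc : ℝ) * (Real.exp κ₀ + 1)) * C * (((Lc : ℝ) ^ ((3 + 1) * (i + 1)))⁻¹ * ((Lc : ℝ) ^ (5 * (k - i + 1)))⁻¹) * E := by ring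
              _ = _ := by rw [e]; ring
        _ ≤ F * (1 + 8 * (Lc : ℝ) * (Real.exp κ₀ + 1)) * C * N5 * (Lc : ℝ) ^ (i + 2) * E :=
            mul_le_mul_of_nonneg_right (mul_le_mul_of_nonneg_left hpow (by positivity)) hE0
  refine (abs_add_le _ _).trans ((add_le_add hA hB).trans (le_of_eq ?_))
  ring

end Up

/-! ## §2 The differenced staircase: `θ^k`-small pieces at scales `≥ 2`, two extra finest pieces at scales `0` and `1` -/

section Diff
include hκ₁ hc hθ hCau hr hrr hF

/-- NOT IN PRINT; OUR BOOKKEEPING.  **(α) AT THE COMB CHART: THE DIFFERENCED PIECES AT SCALES `2 ≤ s′ ≤ k+2` CARRY `θ^k ×` THE UNDIFFERENCED LETTERS** (`d = 3`, in-block roots; PARAMETRIC in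
CT-4a and `F`): `|ΔG′ s′ (blk (Lc^{s′}) u′)| ≤ ((8·Lc + F·(1+8Lc(e^{κ₁}+1)))·(c·θ^k)·(Lc^{5(k+2)})⁻¹·Lc^{s′})·e^{−κ₁‖quo (Lc^(k+2)) u′ − z‖∞}` (`ΔG′` of `combGauge_refine_eq_staircase`) —
road-P2's `abs_gaugePieceDiff_le` ⊕ MY `abs_facePotential_legChain_succ_sub_le` at `ℓ = s′−2`, `j = k+2−s′` (`θ^{ℓ+j} = θ^k` UNIFORMLY in the scale). -/
theorem abs_combPieceDiff_le (k : ℕ) (μ : Fin (3 + 1)) (z : Site (3 + 1)) {s' : ℕ} (hs2 : 2 ≤ s') (hs : s' ≤ k + 2) (u' : Site (3 + 1)) :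
    |(fun (s' : ℕ) (y : Site (3 + 1)) =>
        (if s' ≤ k + 1 then
          (if s' = 0 then -bmGaugeAt (toSite rr) (legAct (respStep (d := 3) 1 (Lc ^ (k + 2))) (delta1 μ z)) Lc y
           else -(((Lc : ℝ) ^ ((3 + 1) * s'))⁻¹ *
             bmGaugeAt (toSite rr) (legAct (respStep (d := 3) (Lc ^ s') (Lc ^ (k + 2))) (delta1 μ z)
               - legAct (respStep (d := 3) (Lc ^ (s' - 1)) (Lc ^ (k + 1))) (delta1 μ z)) Lc y))
         else 0)
        + (if s' = 0 then (0 : ℝ)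
           else if s' = 1 then (((box (3 + 1) Lc).card : ℝ))⁻¹ * zetaS (toSite r) Lc (legAct (legChain (respStepBmSeq (d := 3) (toSite rr) Lc) 0 (k + 1)) (delta1 μ z)) y
           else ((Lc : ℝ) ^ ((3 + 1) * (s' - 1)))⁻¹ * ((((box (3 + 1) Lc).card : ℝ))⁻¹ *
             (zetaS (toSite r) Lc (legAct (legChain (respStepBmSeq (d := 3) (toSite rr) Lc) (s' - 1) (k + 2 - s')) (delta1 μ z)) y
              - zetaS (toSite r) Lc (legAct (legChain (respStepBmSeq (d := 3) (toSite rr) Lc) (s' - 2) (k + 2 - s')) (delta1 μ z)) y))))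
        s' (blk (Lc ^ s') u')|
      ≤ ((8 * (Lc : ℝ) + F * (1 + 8 * (Lc : ℝ) * (Real.exp κ₁ + 1))) * (c * θ ^ k) * ((Lc : ℝ) ^ (5 * (k + 2)))⁻¹ * (Lc : ℝ) ^ s') *
          Real.exp (-(κ₁ * supNorm (quo (Lc ^ (k + 2)) u' - z))) := by
  have hL0 : (0 : ℝ) < Lc := by exact_mod_cast Nat.pos_of_ne_zero (NeZero.ne Lc)
  have hL1 : (1 : ℝ) ≤ Lc := by exact_mod_cast Nat.one_le_iff_ne_zero.2 (NeZero.ne Lc)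
  have hF0 : 0 ≤ F := (faceWtSum_nonneg r Lc).trans hF
  set E : ℝ := Real.exp (-(κ₁ * supNorm (quo (Lc ^ (k + 2)) u' - z))) with hE
  have hE0 : 0 ≤ E := (Real.exp_pos _).le
  set q : ℝ := (c * θ ^ k) * ((Lc : ℝ) ^ (5 * (k + 2)))⁻¹ with hq
  have hq0 : 0 ≤ q := by positivity
  obtain ⟨i, rfl⟩ : ∃ i, s' = i + 2 := ⟨s' - 2, by omega⟩
  have hik : i ≤ k := by omega
  -- the (E) part
  have hA : |(if i + 2 ≤ k + 1 then
          (if i + 2 = 0 then -bmGaugeAt (toSite rr) (legAct (respStep (d := 3) 1 (Lc ^ (k + 2))) (delta1 μ z)) Lc (blk (Lc ^ (i + 2)) u')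
           else -(((Lc : ℝ) ^ ((3 + 1) * (i + 2)))⁻¹ *
             bmGaugeAt (toSite rr) (legAct (respStep (d := 3) (Lc ^ (i + 2)) (Lc ^ (k + 2))) (delta1 μ z)
               - legAct (respStep (d := 3) (Lc ^ (i + 2 - 1)) (Lc ^ (k + 1))) (delta1 μ z)) Lc (blk (Lc ^ (i + 2)) u')))
         else 0)| ≤ 8 * (Lc : ℝ) * q * (Lc : ℝ) ^ (i + 2) * E := by
    by_cases hsk : i + 2 ≤ k + 1
    · rw [if_pos hsk]
      have h := abs_gaugePieceDiff_le (Lc := Lc) hCau hrr k μ z (show 1 ≤ i + 2 by omega) hsk u'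
      rw [← hE] at h
      refine h.trans (le_of_eq ?_)
      rw [hq]; ring
    · rw [if_neg hsk, abs_zero]; positivity
  -- the face part
  have hB : |(if i + 2 = 0 then (0 : ℝ)
           else if i + 2 = 1 then (((box (3 + 1) Lc).card : ℝ))⁻¹ * zetaS (toSite r) Lc (legAct (legChain (respStepBmSeq (d := 3) (toSite rr) Lc) 0 (k + 1)) (delta1 μ z)) (blk (Lc ^ (i + 2)) u')
           else ((Lc : ℝ) ^ ((3 + 1) * (i + 2 - 1)))⁻¹ * ((((box (3 + 1) Lc).card : ℝ))⁻¹ *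
             (zetaS (toSite r) Lc (legAct (legChain (respStepBmSeq (d := 3) (toSite rr) Lc) (i + 2 - 1) (k + 2 - (i + 2))) (delta1 μ z)) (blk (Lc ^ (i + 2)) u')
              - zetaS (toSite r) Lc (legAct (legChain (respStepBmSeq (d := 3) (toSite rr) Lc) (i + 2 - 2) (k + 2 - (i + 2))) (delta1 μ z)) (blk (Lc ^ (i + 2)) u'))))|
        ≤ F * (1 + 8 * (Lc : ℝ) * (Real.exp κ₁ + 1)) * q * (Lc : ℝ) ^ (i + 2) * E := by
    rw [if_neg (show i + 2 ≠ 0 by omega), if_neg (show i + 2 ≠ 1 by omega), show i + 2 - 1 = i + 1 by omega, show i + 2 - 2 = i by omega,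
      show k + 2 - (i + 2) = k - i by omega, mul_sub, show blk (Lc ^ (i + 2)) u' = blk Lc (blk (Lc ^ (i + 1)) u') by rw [blk_blk_pow],
      ← facePotential_apply, ← facePotential_apply, abs_mul, abs_inv, abs_pow, abs_of_pos hL0]
    have h := abs_facePotential_legChain_succ_sub_le hκ₁ hc hθ hCau hr hrr i (k - i) μ z (blk (Lc ^ (i + 1)) u')
    have hlab : quo (Lc ^ (k - i + 1)) (blk (Lc ^ (i + 1)) u') = quo (Lc ^ (k + 2)) u' := by
      show blk (Lc ^ (k - i + 1)) (blk (Lc ^ (i + 1)) u') = blk (Lc ^ (k + 2)) u'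
      rw [blk_pow_blk_pow, show i + 1 + (k - i + 1) = k + 2 by omega]
    rw [hlab, ← hE, show i + (k - i) = k by omega] at h
    have hB0 : 0 ≤ (1 + 8 * (Lc : ℝ) * (Real.exp κ₁ + 1)) * (c * θ ^ k) * ((Lc : ℝ) ^ (5 * (k - i + 1)))⁻¹ * E := by positivity
    have h' := h.trans (mul_le_mul_of_nonneg_right hF hB0)
    have e : ((Lc : ℝ) ^ ((3 + 1) * (i + 1)))⁻¹ * ((Lc : ℝ) ^ (5 * (k - i + 1)))⁻¹ = ((Lc : ℝ) ^ (5 * (k + 2)))⁻¹ * (Lc : ℝ) ^ (i + 1) := by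
      have e' : (Lc : ℝ) ^ (5 * (k + 2)) = (Lc : ℝ) ^ ((3 + 1) * (i + 1)) * (Lc : ℝ) ^ (5 * (k - i + 1)) * (Lc : ℝ) ^ (i + 1) := by
        rw [← pow_add, ← pow_add]; congr 1; omega
      rw [e']; field_simp
    have hpow : (Lc : ℝ) ^ (i + 1) ≤ (Lc : ℝ) ^ (i + 2) := pow_le_pow_right₀ hL1 (by omega)
    calc ((Lc : ℝ) ^ ((3 + 1) * (i + 1)))⁻¹ *
          |facePotential r Lc (legAct (legChain (respStepBmSeq (d := 3) (toSite rr) Lc) (i + 1) (k - i)) (delta1 μ z)) (blk (Lc ^ (i + 1)) u')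
            - facePotential r Lc (legAct (legChain (respStepBmSeq (d := 3) (toSite rr) Lc) i (k - i)) (delta1 μ z)) (blk (Lc ^ (i + 1)) u')|
        ≤ ((Lc : ℝ) ^ ((3 + 1) * (i + 1)))⁻¹ * (F * ((1 + 8 * (Lc : ℝ) * (Real.exp κ₁ + 1)) * (c * θ ^ k) * ((Lc : ℝ) ^ (5 * (k - i + 1)))⁻¹ * E)) :=
          mul_le_mul_of_nonneg_left h' (by positivity)
      _ = F * (1 + 8 * (Lc : ℝ) * (Real.exp κ₁ + 1)) * q * (Lc : ℝ) ^ (i + 1) * E := by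
          rw [hq]
          calc ((Lc : ℝ) ^ ((3 + 1) * (i + 1)))⁻¹ * (F * ((1 + 8 * (Lc : ℝ) * (Real.exp κ₁ + 1)) * (c * θ ^ k) * ((Lc : ℝ) ^ (5 * (k - i + 1)))⁻¹ * E))
              = F * (1 + 8 * (Lc : ℝ) * (Real.exp κ₁ + 1)) * (c * θ ^ k) * (((Lc : ℝ) ^ ((3 + 1) * (i + 1)))⁻¹ * ((Lc : ℝ) ^ (5 * (k - i + 1)))⁻¹) * E := by ring
            _ = _ := by rw [e]; ring
      _ ≤ F * (1 + 8 * (Lc : ℝ) * (Real.exp κ₁ + 1)) * q * (Lc : ℝ) ^ (i + 2) * E :=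
          mul_le_mul_of_nonneg_right (mul_le_mul_of_nonneg_left hpow (by positivity)) hE0
  refine (abs_add_le _ _).trans ((add_le_add hA hB).trans (le_of_eq ?_))
  rw [hq]; ring

end Diff

/-! ## §3 Tower `k`'s own clean-index staircase letters; the two extra finest pieces of the difference staircase -/

section Zero
include hκ₀ hC hN1 hr hrr hF

/-- NOT IN PRINT; OUR BOOKKEEPING.  **THE CLEAN-INDEX CONJUGATED PIECES CARRY MY GEOMETRIC LETTERS** (`d = 3`, in-block roots; PARAMETRIC in (N1) and `F`): for every `s ≤ k+1` and `u`,
`|G′_k s (blk (Lc^s) u)| ≤ ((8·Lc·C + F·(1+8Lc(e^{κ₀}+1))·C)·(Lc^{5(k+1)})⁻¹·Lc^s)·e^{−κ₀‖quo (Lc^(k+1)) u − z‖∞}` (`G′_k` of `combGauge_eq_staircase_zero`) — road-P2's `abs_gaugePieceZero_le` ⊕ the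
OWNER's face envelope (as in MY `CombContactGaugeStaircase.abs_combGaugePiece_le`, clean indices). -/
theorem abs_combPieceZero_le (k : ℕ) (μ : Fin (3 + 1)) (z : Site (3 + 1)) {s : ℕ} (hs : s ≤ k + 1) (u : Site (3 + 1)) :
    |(fun (s : ℕ) (y : Site (3 + 1)) =>
        (if s ≤ k then
          -(((Lc : ℝ) ^ ((3 + 1) * s))⁻¹ * bmGaugeAt (toSite rr) (legAct (respStep (d := 3) (Lc ^ s) (Lc ^ (k + 1))) (delta1 μ z)) Lc y)
         else 0)
        + (if s = 0 then (0 : ℝ)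
           else ((Lc : ℝ) ^ ((3 + 1) * (s - 1)))⁻¹ * ((((box (3 + 1) Lc).card : ℝ))⁻¹ *
             zetaS (toSite r) Lc (legAct (legChain (respStepBmSeq (d := 3) (toSite rr) Lc) (s - 1) (k - (s - 1))) (delta1 μ z)) y)))
        s (blk (Lc ^ s) u)|
      ≤ ((8 * (Lc : ℝ) * C + F * (1 + 8 * (Lc : ℝ) * (Real.exp κ₀ + 1)) * C) * ((Lc : ℝ) ^ (5 * (k + 1)))⁻¹ * (Lc : ℝ) ^ s) *
          Real.exp (-(κ₀ * supNorm (quo (Lc ^ (k + 1)) u - z))) := by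
  have hL0 : (0 : ℝ) < Lc := by exact_mod_cast Nat.pos_of_ne_zero (NeZero.ne Lc)
  have hL1 : (1 : ℝ) ≤ Lc := by exact_mod_cast Nat.one_le_iff_ne_zero.2 (NeZero.ne Lc)
  have hF0 : 0 ≤ F := (faceWtSum_nonneg r Lc).trans hF
  set E : ℝ := Real.exp (-(κ₀ * supNorm (quo (Lc ^ (k + 1)) u - z))) with hE
  have hE0 : 0 ≤ E := (Real.exp_pos _).le
  set N5 : ℝ := ((Lc : ℝ) ^ (5 * (k + 1)))⁻¹ with hN5
  have hN50 : 0 ≤ N5 := by positivity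
  have hA : |(if s ≤ k then
          -(((Lc : ℝ) ^ ((3 + 1) * s))⁻¹ * bmGaugeAt (toSite rr) (legAct (respStep (d := 3) (Lc ^ s) (Lc ^ (k + 1))) (delta1 μ z)) Lc (blk (Lc ^ s) u))
         else 0)| ≤ 8 * (Lc : ℝ) * C * N5 * (Lc : ℝ) ^ s * E := by
    by_cases hsk : s ≤ k
    · rw [if_pos hsk]
      have h := abs_gaugePieceZero_le (Lc := Lc) hN1 hrr k μ z hsk u
      rw [← hE, ← hN5] at h
      exact h
    · rw [if_neg hsk, abs_zero]; positivity
  have hB : |(if s = 0 then (0 : ℝ)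
           else ((Lc : ℝ) ^ ((3 + 1) * (s - 1)))⁻¹ * ((((box (3 + 1) Lc).card : ℝ))⁻¹ *
             zetaS (toSite r) Lc (legAct (legChain (respStepBmSeq (d := 3) (toSite rr) Lc) (s - 1) (k - (s - 1))) (delta1 μ z)) (blk (Lc ^ s) u)))|
        ≤ F * (1 + 8 * (Lc : ℝ) * (Real.exp κ₀ + 1)) * C * N5 * (Lc : ℝ) ^ s * E := by
    rcases Nat.eq_zero_or_pos s with h0 | hpos
    · subst h0; rw [if_pos rfl, abs_zero]; positivity
    · obtain ⟨i, rfl⟩ : ∃ i, s = i + 1 := ⟨s - 1, by omega⟩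
      have hik : i ≤ k := by omega
      rw [if_neg (Nat.succ_ne_zero i), Nat.add_sub_cancel, ← blk_blk_pow, ← facePotential_apply, ← single_eq_delta1, abs_mul, abs_inv, abs_pow, abs_of_pos hL0]
      have h := abs_facePotential_legChain_single_le hκ₀ hC hN1 hr hrr i (k - i) μ z (blk (Lc ^ i) u)
      have hlab : quo (Lc ^ (k - i + 1)) (blk (Lc ^ i) u) = quo (Lc ^ (k + 1)) u := by
        show blk (Lc ^ (k - i + 1)) (blk (Lc ^ i) u) = blk (Lc ^ (k + 1)) u
        rw [blk_pow_blk_pow, show i + (k - i + 1) = k + 1 by omega]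
      rw [hlab, ← hE] at h
      have hB0 : 0 ≤ (1 + 8 * (Lc : ℝ) * (Real.exp κ₀ + 1)) * C * ((Lc : ℝ) ^ (5 * (k - i + 1)))⁻¹ * E := by positivity
      have h' := h.trans (mul_le_mul_of_nonneg_right hF hB0)
      have e : ((Lc : ℝ) ^ ((3 + 1) * i))⁻¹ * ((Lc : ℝ) ^ (5 * (k - i + 1)))⁻¹ = N5 * (Lc : ℝ) ^ i := by
        have e' : (Lc : ℝ) ^ (5 * (k + 1)) = (Lc : ℝ) ^ ((3 + 1) * i) * (Lc : ℝ) ^ (5 * (k - i + 1)) * (Lc : ℝ) ^ i := by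
          rw [← pow_add, ← pow_add]; congr 1; omega
        rw [hN5, e']; field_simp
      have hpow : (Lc : ℝ) ^ i ≤ (Lc : ℝ) ^ (i + 1) := pow_le_pow_right₀ hL1 (Nat.le_succ i)
      calc ((Lc : ℝ) ^ ((3 + 1) * i))⁻¹ * |facePotential r Lc (legAct (legChain (respStepBmSeq (d := 3) (toSite rr) Lc) i (k - i))
              (fun μ' y => if μ' = μ then (if y = z then (1 : ℝ) else 0) else 0)) (blk (Lc ^ i) u)|
          ≤ ((Lc : ℝ) ^ ((3 + 1) * i))⁻¹ * (F * ((1 + 8 * (Lc : ℝ) * (Real.exp κ₀ + 1)) * C * ((Lc : ℝ) ^ (5 * (k - i + 1)))⁻¹ * E)) :=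
            mul_le_mul_of_nonneg_left h' (by positivity)
        _ = F * (1 + 8 * (Lc : ℝ) * (Real.exp κ₀ + 1)) * C * N5 * (Lc : ℝ) ^ i * E := by
            calc ((Lc : ℝ) ^ ((3 + 1) * i))⁻¹ * (F * ((1 + 8 * (Lc : ℝ) * (Real.exp κ₀ + 1)) * C * ((Lc : ℝ) ^ (5 * (k - i + 1)))⁻¹ * E))
                = F * (1 + 8 * (Lc : ℝ) * (Real.exp κ₀ + 1)) * C * (((Lc : ℝ) ^ ((3 + 1) * i))⁻¹ * ((Lc : ℝ) ^ (5 * (k - i + 1)))⁻¹) * E := by ring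
              _ = _ := by rw [e]; ring
        _ ≤ F * (1 + 8 * (Lc : ℝ) * (Real.exp κ₀ + 1)) * C * N5 * (Lc : ℝ) ^ (i + 1) * E :=
            mul_le_mul_of_nonneg_right (mul_le_mul_of_nonneg_left hpow (by positivity)) hE0
  refine (abs_add_le _ _).trans ((add_le_add hA hB).trans (le_of_eq ?_))
  ring

omit hκ₀ hC hr hF in
/-- NOT IN PRINT; OUR BOOKKEEPING.  **(δ) AT THE COMB CHART, SCALE `0`: THE (E) EXTRA FINEST PIECE OF THE TALLER TOWER** (`d = 3`, in-block roots; PARAMETRIC in (N1)): `|ΔG′ 0 u′| ≤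
8·Lc·C·(Lc^{5(k+2)})⁻¹·e^{−κ₀‖quo (Lc^(k+2)) u′ − z‖∞}` — road-P2's `abs_gaugePieceDiff_zero_le` (the face part is EMPTY at scale `0`); NOT small by `θ^k`. -/
theorem abs_combPieceDiff_zero_le (k : ℕ) (μ : Fin (3 + 1)) (z : Site (3 + 1)) (u' : Site (3 + 1)) :
    |(fun (s' : ℕ) (y : Site (3 + 1)) =>
        (if s' ≤ k + 1 then
          (if s' = 0 then -bmGaugeAt (toSite rr) (legAct (respStep (d := 3) 1 (Lc ^ (k + 2))) (delta1 μ z)) Lc y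
           else -(((Lc : ℝ) ^ ((3 + 1) * s'))⁻¹ *
             bmGaugeAt (toSite rr) (legAct (respStep (d := 3) (Lc ^ s') (Lc ^ (k + 2))) (delta1 μ z)
               - legAct (respStep (d := 3) (Lc ^ (s' - 1)) (Lc ^ (k + 1))) (delta1 μ z)) Lc y))
         else 0)
        + (if s' = 0 then (0 : ℝ)
           else if s' = 1 then (((box (3 + 1) Lc).card : ℝ))⁻¹ * zetaS (toSite r) Lc (legAct (legChain (respStepBmSeq (d := 3) (toSite rr) Lc) 0 (k + 1)) (delta1 μ z)) y
           else ((Lc : ℝ) ^ ((3 + 1) * (s' - 1)))⁻¹ * ((((box (3 + 1) Lc).card : ℝ))⁻¹ *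
             (zetaS (toSite r) Lc (legAct (legChain (respStepBmSeq (d := 3) (toSite rr) Lc) (s' - 1) (k + 2 - s')) (delta1 μ z)) y
              - zetaS (toSite r) Lc (legAct (legChain (respStepBmSeq (d := 3) (toSite rr) Lc) (s' - 2) (k + 2 - s')) (delta1 μ z)) y))))
        0 (blk (Lc ^ 0) u')|
      ≤ 8 * (Lc : ℝ) * C * ((Lc : ℝ) ^ (5 * (k + 2)))⁻¹ * Real.exp (-(κ₀ * supNorm (quo (Lc ^ (k + 2)) u' - z))) := by
  have h := abs_gaugePieceDiff_zero_le (Lc := Lc) hN1 hrr k μ z u'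
  simp only [↓reduceIte, zero_le, add_zero, pow_zero, blk_one] at h ⊢
  exact h

end Zero

section One
include hκ₀ hC hκ₁ hc hθ hN1 hCau hr hrr hF

omit hκ₁ hc hθ in
/-- NOT IN PRINT; OUR BOOKKEEPING.  **SCALE `1`: THE DIFFERENCED (E) PIECE (`θ^k`-SMALL) PLUS THE TALLER TOWER's EXTRA FINEST FACE PIECE (NOT SMALL BY `θ^k`)** (`d = 3`, `1 ≤ k+1`, in-block
roots; PARAMETRIC in (N1), CT-4a and `F`): `|ΔG′ 1 (blk Lc u′)| ≤ 8·Lc·(c·θ^k)·(Lc^{5(k+2)})⁻¹·Lc·e^{−κ₁…} + F·(1+8Lc(e^{κ₀}+1))·C·(Lc^{5(k+2)})⁻¹·e^{−κ₀…}` — road-P2's `abs_gaugePieceDiff_le` at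
`s′ = 1` ⊕ the OWNER's `abs_facePotential_legChain_single_le` at base `0`, length `k+1` (`facePotential (…) u′ = |box|⁻¹·ζ_S (…) (blk Lc u′)`). -/
theorem abs_combPieceDiff_one_le (k : ℕ) (μ : Fin (3 + 1)) (z : Site (3 + 1)) (u' : Site (3 + 1)) :
    |(fun (s' : ℕ) (y : Site (3 + 1)) =>
        (if s' ≤ k + 1 then
          (if s' = 0 then -bmGaugeAt (toSite rr) (legAct (respStep (d := 3) 1 (Lc ^ (k + 2))) (delta1 μ z)) Lc y
           else -(((Lc : ℝ) ^ ((3 + 1) * s'))⁻¹ *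
             bmGaugeAt (toSite rr) (legAct (respStep (d := 3) (Lc ^ s') (Lc ^ (k + 2))) (delta1 μ z)
               - legAct (respStep (d := 3) (Lc ^ (s' - 1)) (Lc ^ (k + 1))) (delta1 μ z)) Lc y))
         else 0)
        + (if s' = 0 then (0 : ℝ)
           else if s' = 1 then (((box (3 + 1) Lc).card : ℝ))⁻¹ * zetaS (toSite r) Lc (legAct (legChain (respStepBmSeq (d := 3) (toSite rr) Lc) 0 (k + 1)) (delta1 μ z)) y
           else ((Lc : ℝ) ^ ((3 + 1) * (s' - 1)))⁻¹ * ((((box (3 + 1) Lc).card : ℝ))⁻¹ *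
             (zetaS (toSite r) Lc (legAct (legChain (respStepBmSeq (d := 3) (toSite rr) Lc) (s' - 1) (k + 2 - s')) (delta1 μ z)) y
              - zetaS (toSite r) Lc (legAct (legChain (respStepBmSeq (d := 3) (toSite rr) Lc) (s' - 2) (k + 2 - s')) (delta1 μ z)) y))))
        1 (blk (Lc ^ 1) u')|
      ≤ 8 * (Lc : ℝ) * (c * θ ^ k) * ((Lc : ℝ) ^ (5 * (k + 2)))⁻¹ * (Lc : ℝ) ^ 1 * Real.exp (-(κ₁ * supNorm (quo (Lc ^ (k + 2)) u' - z)))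
        + F * ((1 + 8 * (Lc : ℝ) * (Real.exp κ₀ + 1)) * C * ((Lc : ℝ) ^ (5 * (k + 2)))⁻¹ * Real.exp (-(κ₀ * supNorm (quo (Lc ^ (k + 2)) u' - z)))) := by
  have hF0 : 0 ≤ F := (faceWtSum_nonneg r Lc).trans hF
  -- the (E) part
  have hA := abs_gaugePieceDiff_le (Lc := Lc) hCau hrr k μ z (le_refl 1) (show 1 ≤ k + 1 by omega) u'
  simp only [Nat.succ_ne_zero, ↓reduceIte] at hA
  -- the face part: the extra finest face piece of tower `k+1`
  have hB : |(((box (3 + 1) Lc).card : ℝ))⁻¹ * zetaS (toSite r) Lc (legAct (legChain (respStepBmSeq (d := 3) (toSite rr) Lc) 0 (k + 1)) (delta1 μ z)) (blk (Lc ^ 1) u')|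
      ≤ F * ((1 + 8 * (Lc : ℝ) * (Real.exp κ₀ + 1)) * C * ((Lc : ℝ) ^ (5 * (k + 2)))⁻¹ * Real.exp (-(κ₀ * supNorm (quo (Lc ^ (k + 2)) u' - z)))) := by
    rw [pow_one, ← facePotential_apply, ← single_eq_delta1]
    have h := abs_facePotential_legChain_single_le hκ₀ hC hN1 hr hrr 0 (k + 1) μ z u'
    have hB0 : 0 ≤ (1 + 8 * (Lc : ℝ) * (Real.exp κ₀ + 1)) * C * ((Lc : ℝ) ^ (5 * (k + 1 + 1)))⁻¹ * Real.exp (-(κ₀ * supNorm (quo (Lc ^ (k + 1 + 1)) u' - z))) := by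
      positivity
    exact h.trans (mul_le_mul_of_nonneg_right hF hB0)
  simp only [Nat.succ_ne_zero, ↓reduceIte, show 1 ≤ k + 1 from by omega]
  exact (abs_add_le _ _).trans (add_le_add hA hB)

end One

end Summit.QuantumFields.BalabanUV.Beta.GAN24.CombContactGaugeStaircaseCauchyPack

end
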